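import Summits.Schanuel.Schanuel.Theorems.ZilberEacParamFibreCurveZerosVal
import Summits.Schanuel.Schanuel.Theorems.ZilberEacParamFibreCurveGrowthGap
import Summits.Schanuel.Schanuel.Theorems.ZilberEacParamFibreCurveSubleading
import HarnessLib

/-!
# Polynomially parametrised base curves, XL: the PUISEUX-GAP theorem for fibre curves over
# polynomial curves (all intermediate orders at once; equal degrees with ANY real ratio)

HONEST FRAMING.  Cell `pub-schanuel` (Zilber's Exponential-Algebraic Closedness, case ladder;
host summit Schanuel), seat 2, gen 21.  Surfaces `S(g; Q) = {(g₀(t), g₁(t), y₀, y₁) : Q(t, y₀) = 0}`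
over a polynomial curve with `Q ∈ ℂ[t, y₀]` irreducible with two `y₀`-degrees (the fibre-curve /
`y₁`-cylinder class).  Write `g₁ = c g₀^e + D` (ANY such decomposition).  If the phase of the
polynomial part vanishes, `Re(c i^e) = 0`, and the remainder `D` has degree `m` with
`d(e-1) < m`, `d = deg g₀ ∤ m` (the PUISEUX GAP: `m/d` is a non-integral exponent of
`g₁ ∘ g₀^{-1}` above `e - 1`), then the exponential points of `S(g; Q)` are Zariski dense
(`unprojectedDense_paramSurface₃_of_y0_gap`): along the zeros `t_k` of `Q(t, e^{g₀(t)})` on a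
root direction `ω` with `Re(lc(D) ω^m) ≠ 0` (file XXXVIII: position AND `Re g₀(t_k) = O(log)`),
`|Re g₁(t_k)| ≍ ‖t_k‖^m` by the growth lemma of file XXXIX, and THEOREM G (escape in `x₁`)
concludes.  Canonical form (`d ∣ n`, `e = n/d`, `c = lc(g₁)/lc(g₀)^e`):
`n - d < deg(lc(g₀)^e g₁ - lc(g₁) g₀^e)` (`…_of_y0_gap_canonical`) — gen 20's sub-leading theorem
is the top case `m = n - 1`, the orders `n - 2, …, n - d + 1` are NEW.  EQUAL DEGREES (`e = 1`):
real leading ratio `λ = lc(g₁)/lc(g₀)` — rational OR irrational — and `g₁ - λ g₀` non-constant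
(i.e. the base curve is not a line) ⟹ dense (`unprojectedDense_paramSurface₃_of_y0_realRatio`):
the fibre-curve class over equal-degree curves is thereby COMPLETE (non-real ratio: file XXV).
What stays OPEN for fibre curves: `d ∣ n`, vanishing phase and `deg D ≤ n - d` (then the order
`‖t‖^{n-d} log ‖t‖` decides when the Newton edge is tilted, and an equimodular condition when it
is horizontal — as over graphs, gen 18); non-split `Q` over real-ratio curves beyond gen 20;
general algebraic curves; Fib(3,2); EC(3,2).  Mantova–Masser's question is OPEN in general
(PLMS 2024 §1 p. 5); NOT Schanuel's conjecture (neither used nor implied; EAC ⇏ SC).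
-/

noncomputable section

open Filter Topology Metric Set Complex MvPolynomial
open Literature.NumberTheory.Transcendental Literature.ModelTheory.Zilber
open Literature.ModelTheory.ExponentialFields

set_option linter.dupNamespace false

namespace Summit.Schanuel.Schanuel.Theorems

/-! ## Part A. Escaping exponential points across the Puiseux gap -/

/-- **Zeros of `Q(t, e^{g₀(t)})` on a root direction, with escape of `g₁ = c g₀^e + D` across the
gap.**  `deg g₀ = d ≥ 2`, `Q ∈ ℂ[t, y₀]` with two monomials of different `y₀`-degree, `ω` a root
direction of `lc(g₀) X^d`, `Re(c i^e) = 0`, `deg D ≥ d(e-1) + 1`, `Re(lc(D) ω^{deg D}) ≠ 0`.  Then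
there are `t_k` with `Q(t_k; e^{g₀(t_k)}, e^{g₁(t_k)}) = 0` and `|Re g₁(t_k)|/log(2 + ‖g₁(t_k)‖) → ∞`.
(new) -/
theorem exists_paramSurface_expPoints_of_y0_gap (g₀ g₁ : Polynomial ℂ)
    (hd : 2 ≤ g₀.natDegree) (Q : MvPolynomial (Fin 3) ℂ)
    (hQ2 : ∀ m ∈ Q.support, m 2 = 0) (h1 : ∃ m ∈ Q.support, ∃ m' ∈ Q.support, m 1 ≠ m' 1)
    {c : ℂ} {e : ℕ} {D : Polynomial ℂ} (hD : g₁ = Polynomial.C c * g₀ ^ e + D)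
    (hph : (c * I ^ e).re = 0) (hgap : g₀.natDegree * (e - 1) + 1 ≤ D.natDegree)
    {ω : ℂ} {σ : ℤ} (hσ : σ = 1 ∨ σ = -1)
    (hω : g₀.leadingCoeff * ω ^ g₀.natDegree = 2 * Real.pi * I * σ)
    (hdir : (D.leadingCoeff * ω ^ D.natDegree).re ≠ 0) :
    ∃ t : ℕ → ℂ, (∀ k, MvPolynomial.eval ![t k, exp (g₀.eval (t k)), exp (g₁.eval (t k))] Q = 0) ∧
      Tendsto (fun k => |(g₁.eval (t k)).re| / Real.log (2 + ‖g₁.eval (t k)‖)) atTop atTop := by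
  classical
  -- coefficient polynomials and exponents (as in files XXI/XXXI)
  set q : (Fin 3 →₀ ℕ) → Polynomial ℂ := fun m =>
    Polynomial.C (Q.coeff m) * Polynomial.X ^ (m 0) with hq_def
  set ex : (Fin 3 →₀ ℕ) → ℕ := fun m => m 1 with hex_def
  have hq_deg : ∀ m ∈ Q.support, (q m).natDegree = m 0 := fun m hm =>
    Polynomial.natDegree_C_mul_X_pow _ _ (MvPolynomial.mem_support_iff.1 hm)
  have hq_lc : ∀ m, (q m).leadingCoeff = Q.coeff m := fun m =>
    Polynomial.leadingCoeff_C_mul_X_pow _ _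
  obtain ⟨μ, κ, hκ, ma, hma, mc, hmc, hjne, hja, hjc⟩ := exists_upper_edge Q.support ex
    (fun m => m 0) h1
  have hκ' : ∀ m ∈ Q.support, ((q m).natDegree : ℝ) + μ * ex m ≤ κ := fun m hm => by
    rw [hq_deg m hm]; exact hκ m hm
  set Jt := Q.support.filter (fun m => ((q m).natDegree : ℝ) + μ * ex m = κ) with hJt
  set Qμ : Polynomial ℂ := ∑ m ∈ Jt, Polynomial.C (q m).leadingCoeff * Polynomial.X ^ (ex m)
    with hQμ
  have hmem_top : ∀ {m}, m ∈ Q.support → ((m 0 : ℝ) + μ * ex m = κ) → m ∈ Jt := fun {m} hm h =>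
    Finset.mem_filter.2 ⟨hm, by rw [hq_deg m hm]; exact h⟩
  have hmaT : ma ∈ Jt := hmem_top hma hja
  have hmcT : mc ∈ Jt := hmem_top hmc hjc
  have hinj : ∀ m ∈ Jt, ∀ m' ∈ Jt, ex m = ex m' → m = m' := by
    intro m hm m' hm' hee
    obtain ⟨hmM, hmt⟩ := Finset.mem_filter.1 hm
    obtain ⟨hm'M, hm't⟩ := Finset.mem_filter.1 hm'
    have h0eq : m 0 = m' 0 := by
      rw [hq_deg m hmM] at hmt; rw [hq_deg m' hm'M] at hm't
      rw [hee] at hmt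
      have : (m 0 : ℝ) = m' 0 := by linarith
      exact_mod_cast this
    have h1eq : m 1 = m' 1 := hee
    have h2eq : m 2 = m' 2 := by rw [hQ2 m hmM, hQ2 m' hm'M]
    ext i
    fin_cases i
    · exact h0eq
    · exact h1eq
    · exact h2eq
  have hcoeff : ∀ m₁ ∈ Jt, Qμ.coeff (ex m₁) = Q.coeff m₁ := by
    intro m₁ hm₁
    rw [hQμ, Polynomial.finsetSum_coeff, Finset.sum_eq_single m₁]
    · rw [Polynomial.coeff_C_mul, Polynomial.coeff_X_pow, if_pos rfl, mul_one, hq_lc]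
    · intro m hm hne
      rw [Polynomial.coeff_C_mul, Polynomial.coeff_X_pow, if_neg, mul_zero]
      exact fun h => hne (hinj m hm m₁ hm₁ h.symm)
    · intro h; exact (h hm₁).elim
  have hca : Qμ.coeff (ex ma) ≠ 0 := by
    rw [hcoeff ma hmaT]; exact MvPolynomial.mem_support_iff.1 hma
  have hcc : Qμ.coeff (ex mc) ≠ 0 := by
    rw [hcoeff mc hmcT]; exact MvPolynomial.mem_support_iff.1 hmc
  obtain ⟨θ, hθ0, hθ⟩ : ∃ θ : ℂ, θ ≠ 0 ∧ Qμ.eval θ = 0 := by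
    rcases lt_or_gt_of_ne hjne with hlt | hgt
    · exact exists_root_ne_zero_of_coeff_ne_zero (ex mc) Qμ (ex ma) hlt hca hcc
    · exact exists_root_ne_zero_of_coeff_ne_zero (ex ma) Qμ (ex mc) hgt hcc hca
  have hQ : Qμ ≠ 0 := fun h => hca (by rw [h, Polynomial.coeff_zero])
  -- located zeros with the value datum
  obtain ⟨t, ns, hns, ht, hpos, B, hval⟩ := exists_zeros_log_dir_val g₀ hd Q.support q ex μ κ hκ'
    hθ0 hθ hQ ω σ hσ hω
  refine ⟨t, fun k => ?_, ?_⟩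
  · rw [eval₃_eq_sum_coeffPoly_of_y0 Q hQ2]
    have h := ht k
    simpa only [hq_def, hex_def, ← Complex.exp_nat_mul, Polynomial.eval_mul, Polynomial.eval_C,
      Polynomial.eval_pow, Polynomial.eval_X] using h
  · -- growth across the gap
    have hρ : Tendsto (fun k => ((ns k : ℝ)) + 1) atTop atTop :=
      tendsto_atTop_add_const_right _ _ (tendsto_natCast_atTop_atTop.comp hns)
    rw [hD]
    refine tendsto_growth_eval_of_gap g₀ c e hph D hgap ω
      (-(g₀.coeff (g₀.natDegree - 1) / (g₀.natDegree * g₀.leadingCoeff))) hdir hρ ?_ hval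
    refine hpos.congr fun k => ?_
    rw [natCast_add_one_eq_ofReal]

/-! ## Part B. The density theorems across the Puiseux gap -/

section Main

variable (g₀ g₁ : Polynomial ℂ) {Q : MvPolynomial (Fin 3) ℂ}

/-- **MAIN THEOREM (Puiseux gap, any decomposition).**  `d = deg g₀ ≥ 2`, `g₁ = c g₀^e + D` with
`Re(c i^e) = 0`, `m = deg D > d(e-1)` and `d ∤ m`; `Q ∈ ℂ[t, y₀]` (no `y₁`) irreducible with two
monomials of different `y₀`-degree ⟹ the exponential points of
`S(g; Q) = {(g₀(t), g₁(t), y₀, y₁) : Q(t, y₀) = 0}` are Zariski dense.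
[cite: MantovaMasser2023, §1 Further remarks, p. 5 (the question, open in general)] (new) -/
theorem unprojectedDense_paramSurface₃_of_y0_gap (hd : 2 ≤ g₀.natDegree)
    {c : ℂ} {e : ℕ} {D : Polynomial ℂ} (hD : g₁ = Polynomial.C c * g₀ ^ e + D)
    (hph : (c * I ^ e).re = 0) (hgap : g₀.natDegree * (e - 1) + 1 ≤ D.natDegree)
    (hndvd : ¬ g₀.natDegree ∣ D.natDegree)
    (hirr : Irreducible Q) (hQ2 : ∀ m ∈ Q.support, m 2 = 0)
    (h1 : ∃ m ∈ Q.support, ∃ m' ∈ Q.support, m 1 ≠ m' 1) :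
    UnprojectedDense {w : Fin 2 ⊕ Fin 2 → ℂ | ∃ t : ℂ, w (Sum.inl 0) = g₀.eval t ∧
      w (Sum.inl 1) = g₁.eval t ∧
      MvPolynomial.eval (Fin.cases t (fun i => w (Sum.inr i)) : Fin 3 → ℂ) Q = 0} := by
  have hg₀ : 1 ≤ g₀.natDegree := by omega
  have hg0 : g₀ ≠ 0 := by rintro rfl; rw [Polynomial.natDegree_zero] at hd; omega
  have ha0 : g₀.leadingCoeff ≠ 0 := Polynomial.leadingCoeff_ne_zero.2 hg0
  have hD0 : D ≠ 0 := by rintro rfl; rw [Polynomial.natDegree_zero] at hgap; omega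
  have hb0 : D.leadingCoeff ≠ 0 := Polynomial.leadingCoeff_ne_zero.2 hD0
  obtain ⟨ω, σ, hσ, hω, hre⟩ := exists_rootDirection_re_ne_zero g₀.leadingCoeff D.leadingCoeff
    ha0 hb0 hd (Or.inl hndvd)
  obtain ⟨t, ht, hgr⟩ := exists_paramSurface_expPoints_of_y0_gap g₀ g₁ hd Q hQ2 h1 hD hph hgap
    hσ hω hre
  exact unprojectedDense_paramSurface₃_of_expPoints₁ g₀ g₁ Q ht hgr
    (isIrreducibleClosed_paramSurface₃ g₀ g₁ hg₀ hirr)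
    (by rw [zariskiDim_paramSurface₃ g₀ g₁ hg₀ hirr])

/-- The canonical remainder `lc(g₀)^e g₁ - lc(g₁) g₀^e` (`d ∣ n`, `e = n/d`) has degree `< n`.
(new) -/
theorem natDegree_gapPoly_lt (hn : 1 ≤ g₁.natDegree)
    (hdvd : g₀.natDegree ∣ g₁.natDegree) :
    (Polynomial.C (g₀.leadingCoeff ^ (g₁.natDegree / g₀.natDegree)) * g₁ -
        Polynomial.C g₁.leadingCoeff * g₀ ^ (g₁.natDegree / g₀.natDegree)).natDegree <
      g₁.natDegree := by
  set e := g₁.natDegree / g₀.natDegree with he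
  have hne : g₀.natDegree * e = g₁.natDegree := Nat.mul_div_cancel' hdvd
  have hg1 : g₁ ≠ 0 := by rintro rfl; rw [Polynomial.natDegree_zero] at hn; omega
  set P := Polynomial.C (g₀.leadingCoeff ^ e) * g₁ - Polynomial.C g₁.leadingCoeff * g₀ ^ e with hP
  have hle : P.natDegree ≤ g₁.natDegree := by
    refine (Polynomial.natDegree_sub_le _ _).trans (max_le (Polynomial.natDegree_C_mul_le _ _) ?_)
    refine (Polynomial.natDegree_C_mul_le _ _).trans ?_
    refine (Polynomial.natDegree_pow_le).trans ?_
    rw [mul_comm, hne]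
  have hcoeff : P.coeff g₁.natDegree = 0 := by
    rw [hP, Polynomial.coeff_sub, Polynomial.coeff_C_mul, Polynomial.coeff_C_mul,
      Polynomial.coeff_natDegree, ← hne, mul_comm g₀.natDegree e,
      Polynomial.coeff_pow_mul_natDegree]
    ring
  by_contra hge
  have heq : P.natDegree = g₁.natDegree := le_antisymm hle (not_lt.1 hge)
  have hP0 : P ≠ 0 := by
    intro h0; rw [h0, Polynomial.natDegree_zero] at heq; omega
  have := Polynomial.leadingCoeff_ne_zero.2 hP0
  rw [Polynomial.leadingCoeff, heq, hcoeff] at this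
  exact this rfl

/-- **MAIN THEOREM (Puiseux gap, canonical form).**  `d = deg g₀ ≥ 2`, `n = deg g₁`, `d ∣ n`,
`e = n/d`, VANISHING phase `Re(lc(g₁)(i/lc(g₀))^e) = 0`, and the GAP
`n - d < deg(lc(g₀)^e g₁ - lc(g₁) g₀^e)`; `Q ∈ ℂ[t, y₀]` irreducible with two `y₀`-degrees ⟹ the
exponential points of `S(g; Q)` are Zariski dense.  (Gen 20's sub-leading theorem is the case
`deg = n - 1`.) [cite: MantovaMasser2023, §1 Further remarks, p. 5 (the question, open in
general)] (new) -/
theorem unprojectedDense_paramSurface₃_of_y0_gap_canonical (hd : 2 ≤ g₀.natDegree)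
    (hn : 1 ≤ g₁.natDegree) (hdvd : g₀.natDegree ∣ g₁.natDegree)
    (hph0 : (g₁.leadingCoeff * (I / g₀.leadingCoeff) ^ (g₁.natDegree / g₀.natDegree)).re = 0)
    (hgap : g₁.natDegree < (Polynomial.C (g₀.leadingCoeff ^ (g₁.natDegree / g₀.natDegree)) * g₁ -
        Polynomial.C g₁.leadingCoeff * g₀ ^ (g₁.natDegree / g₀.natDegree)).natDegree +
      g₀.natDegree)
    (hirr : Irreducible Q) (hQ2 : ∀ m ∈ Q.support, m 2 = 0)
    (h1 : ∃ m ∈ Q.support, ∃ m' ∈ Q.support, m 1 ≠ m' 1) :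
    UnprojectedDense {w : Fin 2 ⊕ Fin 2 → ℂ | ∃ t : ℂ, w (Sum.inl 0) = g₀.eval t ∧
      w (Sum.inl 1) = g₁.eval t ∧
      MvPolynomial.eval (Fin.cases t (fun i => w (Sum.inr i)) : Fin 3 → ℂ) Q = 0} := by
  have hg0 : g₀ ≠ 0 := by rintro rfl; rw [Polynomial.natDegree_zero] at hd; omega
  have ha0 : g₀.leadingCoeff ≠ 0 := Polynomial.leadingCoeff_ne_zero.2 hg0
  set e := g₁.natDegree / g₀.natDegree with he
  set a := g₀.leadingCoeff with ha
  have hae : a ^ e ≠ 0 := pow_ne_zero _ ha0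
  have hne : g₀.natDegree * e = g₁.natDegree := Nat.mul_div_cancel' hdvd
  -- the decomposition `g₁ = c g₀^e + D`, `c = lc₁ / a^e`, `D = (a^e g₁ - lc₁ g₀^e) / a^e`
  set c : ℂ := g₁.leadingCoeff / a ^ e with hc
  set P := Polynomial.C (a ^ e) * g₁ - Polynomial.C g₁.leadingCoeff * g₀ ^ e with hP
  set D := Polynomial.C ((a ^ e)⁻¹) * P with hDdef
  have hD : g₁ = Polynomial.C c * g₀ ^ e + D := by
    rw [hDdef, hP, hc, div_eq_mul_inv, mul_sub, ← mul_assoc, ← mul_assoc, ← Polynomial.C_mul,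
      ← Polynomial.C_mul, inv_mul_cancel₀ hae, Polynomial.C_1, one_mul, mul_comm _⁻¹]
    ring
  have hDdeg : D.natDegree = P.natDegree := by
    rw [hDdef, Polynomial.natDegree_C_mul (inv_ne_zero hae)]
  have hph : (c * I ^ e).re = 0 := by
    rw [hc, show g₁.leadingCoeff / a ^ e * I ^ e = g₁.leadingCoeff * (I / a) ^ e by
      rw [div_pow]; ring]
    exact hph0
  have hPlt : P.natDegree < g₁.natDegree := natDegree_gapPoly_lt g₀ g₁ hn hdvd
  have he : 0 < e := by
    rcases Nat.eq_zero_or_pos e with h0 | h0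
    · rw [h0, mul_zero] at hne; omega
    · exact h0
  have hmul : g₀.natDegree * (e - 1) + g₀.natDegree = g₀.natDegree * e := by
    rw [Nat.mul_sub_one, Nat.sub_add_cancel]
    exact Nat.le_mul_of_pos_right _ he
  have hgapP : g₁.natDegree < P.natDegree + g₀.natDegree := hgap
  have hgap' : g₀.natDegree * (e - 1) + 1 ≤ D.natDegree := by
    rw [hDdeg]; omega
  have hndvd : ¬ g₀.natDegree ∣ D.natDegree := by
    rw [hDdeg]
    rintro ⟨k, hk⟩
    -- `d(e-1) < dk < de` is impossible
    have h1 : g₀.natDegree * (e - 1) < g₀.natDegree * k := by omega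
    have h2 : g₀.natDegree * k < g₀.natDegree * e := by omega
    have h1' := Nat.lt_of_mul_lt_mul_left h1
    have h2' := Nat.lt_of_mul_lt_mul_left h2
    omega
  exact unprojectedDense_paramSurface₃_of_y0_gap g₀ g₁ hd hD hph hgap' hndvd hirr hQ2 h1

/-- **EQUAL DEGREES WITH ANY REAL LEADING RATIO (fibre curves).**  `deg g₀ = deg g₁ = n ≥ 2`,
`λ = lc(g₁)/lc(g₀) ∈ ℝ` (rational or irrational) and `lc(g₀) g₁ - lc(g₁) g₀` NON-CONSTANT (the base
curve is not a line); `Q ∈ ℂ[t, y₀]` irreducible with two `y₀`-degrees ⟹ the exponential points of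
`S(g; Q)` are Zariski dense.  (Along the zeros `Re g₀ = O(log)`, so
`Re g₁ = λ Re g₀ + Re D ≍ ‖t‖^{deg D}` on a good root direction.)
[cite: MantovaMasser2023, §1 Further remarks, p. 5 (the question, open in general)] (new) -/
theorem unprojectedDense_paramSurface₃_of_y0_realRatio (hd : 2 ≤ g₀.natDegree)
    (heq : g₁.natDegree = g₀.natDegree) (him : (g₁.leadingCoeff / g₀.leadingCoeff).im = 0)
    (hD : 1 ≤ (Polynomial.C g₀.leadingCoeff * g₁ - Polynomial.C g₁.leadingCoeff * g₀).natDegree)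
    (hirr : Irreducible Q) (hQ2 : ∀ m ∈ Q.support, m 2 = 0)
    (h1 : ∃ m ∈ Q.support, ∃ m' ∈ Q.support, m 1 ≠ m' 1) :
    UnprojectedDense {w : Fin 2 ⊕ Fin 2 → ℂ | ∃ t : ℂ, w (Sum.inl 0) = g₀.eval t ∧
      w (Sum.inl 1) = g₁.eval t ∧
      MvPolynomial.eval (Fin.cases t (fun i => w (Sum.inr i)) : Fin 3 → ℂ) Q = 0} := by
  have hdvd : g₀.natDegree ∣ g₁.natDegree := heq ▸ dvd_rfl
  have he1 : g₁.natDegree / g₀.natDegree = 1 := by rw [heq, Nat.div_self (by omega)]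
  refine unprojectedDense_paramSurface₃_of_y0_gap_canonical g₀ g₁ hd (by omega) hdvd ?_ ?_ hirr
    hQ2 h1
  · rw [he1, pow_one, show g₁.leadingCoeff * (I / g₀.leadingCoeff) =
      g₁.leadingCoeff / g₀.leadingCoeff * I by ring, Complex.mul_I_re, him, neg_zero]
  · rw [he1, pow_one, pow_one]
    omega

/-- **Independence for equal degrees from a non-constant remainder.**  `deg g₀ = deg g₁ ≥ 1` and
`lc(g₀) g₁ - lc(g₁) g₀` non-constant ⟹ no relation `m₀ g₀ + m₁ g₁ = c`, `m ∈ ℤ² ∖ 0`. (new) -/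
theorem paramCurve_indep_of_remainder (hg₀ : 1 ≤ g₀.natDegree) (heq : g₁.natDegree = g₀.natDegree)
    (hD : 1 ≤ (Polynomial.C g₀.leadingCoeff * g₁ - Polynomial.C g₁.leadingCoeff * g₀).natDegree)
    (m : Fin 2 → ℤ) (hm : m ≠ 0) (c : ℂ) :
    Polynomial.C (m 0 : ℂ) * g₀ + Polynomial.C (m 1 : ℂ) * g₁ ≠ Polynomial.C c := by
  intro h
  have hg0 : g₀ ≠ 0 := by rintro rfl; rw [Polynomial.natDegree_zero] at hg₀; omega
  have ha0 : g₀.leadingCoeff ≠ 0 := Polynomial.leadingCoeff_ne_zero.2 hg0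
  set n := g₀.natDegree with hn
  -- top coefficients: `m₀ lc₀ + m₁ lc₁ = 0`
  have htop := congrArg (fun p => p.coeff n) h
  simp only [Polynomial.coeff_add, Polynomial.coeff_C_mul, Polynomial.coeff_C] at htop
  rw [if_neg (by omega : n ≠ 0)] at htop
  have hlc0 : g₀.coeff n = g₀.leadingCoeff := by rw [Polynomial.leadingCoeff, hn]
  have hlc1 : g₁.coeff n = g₁.leadingCoeff := by rw [Polynomial.leadingCoeff, heq]
  rw [hlc0, hlc1] at htop
  -- `lc₀ (m₀ g₀ + m₁ g₁) = m₁ (lc₀ g₁ - lc₁ g₀)`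
  have hid : Polynomial.C (m 1 : ℂ) *
      (Polynomial.C g₀.leadingCoeff * g₁ - Polynomial.C g₁.leadingCoeff * g₀) =
        Polynomial.C (g₀.leadingCoeff * c) := by
    have e1 : Polynomial.C g₀.leadingCoeff * (Polynomial.C (m 0 : ℂ) * g₀ +
        Polynomial.C (m 1 : ℂ) * g₁) = Polynomial.C (g₀.leadingCoeff * c) := by
      rw [h, ← Polynomial.C_mul]
    rw [← e1]
    have e2 : Polynomial.C ((m 0 : ℂ) * g₀.leadingCoeff) =
        Polynomial.C (-((m 1 : ℂ) * g₁.leadingCoeff)) := by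
      congr 1; linear_combination htop
    calc Polynomial.C (m 1 : ℂ) *
          (Polynomial.C g₀.leadingCoeff * g₁ - Polynomial.C g₁.leadingCoeff * g₀)
        = Polynomial.C (m 1 : ℂ) * Polynomial.C g₀.leadingCoeff * g₁ -
            Polynomial.C ((m 1 : ℂ) * g₁.leadingCoeff) * g₀ := by rw [Polynomial.C_mul]; ring
      _ = Polynomial.C (m 1 : ℂ) * Polynomial.C g₀.leadingCoeff * g₁ +
            Polynomial.C ((m 0 : ℂ) * g₀.leadingCoeff) * g₀ := by rw [e2, Polynomial.C_neg]; ring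
      _ = Polynomial.C g₀.leadingCoeff * (Polynomial.C (m 0 : ℂ) * g₀ +
            Polynomial.C (m 1 : ℂ) * g₁) := by rw [Polynomial.C_mul]; ring
  have hm1 : (m 1 : ℂ) ≠ 0 := by
    intro h0
    have hm0 : (m 0 : ℂ) = 0 := by
      have h2 := htop
      rw [h0, zero_mul, add_zero] at h2
      exact (mul_eq_zero.1 h2).resolve_right ha0
    apply hm
    funext i
    fin_cases i
    · exact_mod_cast hm0
    · exact_mod_cast h0
  have hdeg := congrArg Polynomial.natDegree hid
  rw [Polynomial.natDegree_C_mul hm1, Polynomial.natDegree_C] at hdeg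
  omega

/-- **Mantova–Masser's question for fibre curves over an equal-degree curve with real leading
ratio: case ∧ dense** (rational or irrational ratio; the base curve not a line; a nonzero fibre
root over infinitely many `t`). [cite: MantovaMasser2023, §1 Further remarks, p. 5 (the
question, open in general)] (new) -/
theorem unprojectedDensityQuestion_instance_paramSurface₃_of_y0_realRatio (hd : 2 ≤ g₀.natDegree)
    (heq : g₁.natDegree = g₀.natDegree) (him : (g₁.leadingCoeff / g₀.leadingCoeff).im = 0)
    (hD : 1 ≤ (Polynomial.C g₀.leadingCoeff * g₁ - Polynomial.C g₁.leadingCoeff * g₀).natDegree)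
    (hirr : Irreducible Q) (hQ2 : ∀ m ∈ Q.support, m 2 = 0)
    (h1 : ∃ m ∈ Q.support, ∃ m' ∈ Q.support, m 1 ≠ m' 1)
    (hfib : Set.Infinite {t : ℂ | ∃ y : ℂ, y ≠ 0 ∧ MvPolynomial.eval ![t, y, 1] Q = 0}) :
    MMCaseDimPiOneFree {w : Fin 2 ⊕ Fin 2 → ℂ | ∃ t : ℂ, w (Sum.inl 0) = g₀.eval t ∧
        w (Sum.inl 1) = g₁.eval t ∧
        MvPolynomial.eval (Fin.cases t (fun i => w (Sum.inr i)) : Fin 3 → ℂ) Q = 0} ∧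
      UnprojectedDense {w : Fin 2 ⊕ Fin 2 → ℂ | ∃ t : ℂ, w (Sum.inl 0) = g₀.eval t ∧
        w (Sum.inl 1) = g₁.eval t ∧
        MvPolynomial.eval (Fin.cases t (fun i => w (Sum.inr i)) : Fin 3 → ℂ) Q = 0} :=
  ⟨mmCase_paramSurface₃_of_y0 g₀ g₁ (by omega) (paramCurve_indep_of_remainder g₀ g₁ (by omega) heq hD)
    hirr hfib, unprojectedDense_paramSurface₃_of_y0_realRatio g₀ g₁ hd heq him hD hirr hQ2 h1⟩

/-- **Mantova–Masser's question across the Puiseux gap (canonical form): case ∧ dense.**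
`2 ≤ d`, `d ∣ n`, `d < n`, vanishing phase, gap `n - d < deg(lc(g₀)^e g₁ - lc(g₁) g₀^e)`, a
nonzero fibre root over infinitely many `t`. [cite: MantovaMasser2023, §1 Further remarks,
p. 5 (the question, open in general)] (new) -/
theorem unprojectedDensityQuestion_instance_paramSurface₃_of_y0_gap (hd : 2 ≤ g₀.natDegree)
    (hlt : g₀.natDegree < g₁.natDegree) (hdvd : g₀.natDegree ∣ g₁.natDegree)
    (hph0 : (g₁.leadingCoeff * (I / g₀.leadingCoeff) ^ (g₁.natDegree / g₀.natDegree)).re = 0)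
    (hgap : g₁.natDegree < (Polynomial.C (g₀.leadingCoeff ^ (g₁.natDegree / g₀.natDegree)) * g₁ -
        Polynomial.C g₁.leadingCoeff * g₀ ^ (g₁.natDegree / g₀.natDegree)).natDegree +
      g₀.natDegree)
    (hirr : Irreducible Q) (hQ2 : ∀ m ∈ Q.support, m 2 = 0)
    (h1 : ∃ m ∈ Q.support, ∃ m' ∈ Q.support, m 1 ≠ m' 1)
    (hfib : Set.Infinite {t : ℂ | ∃ y : ℂ, y ≠ 0 ∧ MvPolynomial.eval ![t, y, 1] Q = 0}) :
    MMCaseDimPiOneFree {w : Fin 2 ⊕ Fin 2 → ℂ | ∃ t : ℂ, w (Sum.inl 0) = g₀.eval t ∧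
        w (Sum.inl 1) = g₁.eval t ∧
        MvPolynomial.eval (Fin.cases t (fun i => w (Sum.inr i)) : Fin 3 → ℂ) Q = 0} ∧
      UnprojectedDense {w : Fin 2 ⊕ Fin 2 → ℂ | ∃ t : ℂ, w (Sum.inl 0) = g₀.eval t ∧
        w (Sum.inl 1) = g₁.eval t ∧
        MvPolynomial.eval (Fin.cases t (fun i => w (Sum.inr i)) : Fin 3 → ℂ) Q = 0} :=
  ⟨mmCase_paramSurface₃_of_y0 g₀ g₁ (by omega)
    (paramCurve_indep_of_ne g₀ g₁ (by omega) (by omega) (by omega)) hirr hfib,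
    unprojectedDense_paramSurface₃_of_y0_gap_canonical g₀ g₁ hd (by omega) hdvd hph0 hgap hirr
      hQ2 h1⟩

end Main

end Summit.Schanuel.Schanuel.Theorems
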